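import Summits.Ventures.GridStability.Models.DroopQVPortHamiltonianFilters
import Summits.Ventures.GridStability.Models.DroopQVGainQAffine

/-!
# GridStability/Models/DroopQVPortHamiltonianQGains — the sharp solver-free lane is MONOTONE in the Q–V droop gains: smaller `k_Q` keeps the Hessian certificate

Cell `gridfusion` (LADDER-GRIDFUSION, APEX LINE rung G3.b; seat gridfusion-model-8 (g4); sequel of `Models/DroopQVPortHamiltonianGains.lean` /
`…Filters.lean`). The Q–V droop gains enter the Hessian pattern `𝒬` ([cite: ShinZavala2020, eqs. (10)–(11)]) only through the diagonal addition
`diag(V)⁻¹·diag(k_Q)⁻¹` of the voltage block: `hessQ (withKQ κ_Q) = hessQ + diag(0, 0, V⁻¹(κ_Q⁻¹ − k_Q⁻¹))` (`hessQ_withKQ_eq_add`). For positive voltages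
and `0 < κ_Qi ≤ k_Qi` the addition is positive semidefinite, so the certificate `𝒬 + c·r rᵀ ≻ 0` SURVIVES (`hessQ_add_rankOne_posDef_withKQ`) and p525467's
sharp theorem applies (`re_eig_neg_or_rotation_of_hessQ_withKQ`): for every Q–V gain vector below the certified one, `Re μ < 0` or the rotation mode.
Combined with `withGainsTau` (all P–f gains and filter constants free, `…Filters.lean`): `re_eig_neg_or_rotation_of_hessQ_allLoops` — ALL `4n` loop parameters
of model N1 ([cite: KunduEtAl2019, eqs. (4a)–(4c)]) move (three families over the positive orthant, `k_Q` over `(0, k_Q]`) on ONE certificate. THREE COLUMNS.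
CERTIFIED (kernel): matrix statements about MODEL N1 (MV-6N); no instance, no numbers, no rate; no sentence of this file says a converter or a microgrid is stable.
-/

noncomputable section

open Real Matrix Finset
open scoped ComplexOrder

namespace Summit.Ventures.GridStability.Models

namespace DroopMicrogrid

variable {n : ℕ} (mg : DroopMicrogrid n) (κQ : Fin n → ℝ)

/-- The diagonal shift of the voltage block produced by changing the Q–V gains: `diag(0, 0, V⁻¹(κ_Q⁻¹ − k_Q⁻¹))`. [folklore] -/
def kQShift (V : Fin n → ℝ) : Matrix (Fin n ⊕ (Fin n ⊕ Fin n)) (Fin n ⊕ (Fin n ⊕ Fin n)) ℝ :=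
  Matrix.diagonal (Sum.elim (fun _ => (0 : ℝ)) (Sum.elim (fun _ => (0 : ℝ)) (fun i => (V i)⁻¹ * ((κQ i)⁻¹ - (mg.kQ i)⁻¹))))

/-- **The Hessian pattern is additive in `diag(k_Q)⁻¹`**: `hessQ (withKQ κ_Q) = hessQ + diag(0, 0, V⁻¹(κ_Q⁻¹ − k_Q⁻¹))`.
[cite: ShinZavala2020, eqs. (10)–(11)] -/
theorem hessQ_withKQ_eq_add (θ V : Fin n → ℝ) : (mg.withKQ κQ).hessQ θ V = mg.hessQ θ V + mg.kQShift κQ V := by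
  ext a b
  rcases a with i | i | i <;> rcases b with j | j | j <;>
    simp [DroopMicrogrid.hessQ, block3, kQShift, Matrix.fromBlocks, Matrix.fromCols, Matrix.fromRows, Matrix.mul_apply, Matrix.diagonal_apply,
      Matrix.add_apply]
  · -- the voltage block: `V_i⁻¹ (QV_ij + [i=j]/κ_i) = V_i⁻¹ (QV_ij + [i=j]/k_i) + [i=j] V_i⁻¹ (1/κ_i − 1/k_i)`
    split_ifs with h
    · subst h; ring
    · ring

/-- The shift is positive semidefinite for positive voltages and `κ_Qi⁻¹ ≥ k_Qi⁻¹`. [folklore] -/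
theorem kQShift_posSemidef (V : Fin n → ℝ) (hV : ∀ i, 0 < V i) (hle : ∀ i, (mg.kQ i)⁻¹ ≤ (κQ i)⁻¹) : (mg.kQShift κQ V).PosSemidef := by
  refine Matrix.PosSemidef.diagonal fun a => ?_
  rcases a with i | i | i
  · simp
  · simp
  · simp only [Sum.elim_inr]
    exact mul_nonneg (inv_pos.2 (hV i)).le (sub_nonneg.2 (hle i))

variable {κQ}

/-- **The certificate survives smaller Q–V gains**: `𝒬 + c·r rᵀ ≻ 0` for `mg` implies the same for `withKQ κ_Q` when `V > 0` and `κ_Qi⁻¹ ≥ k_Qi⁻¹`. CERTIFIED. [folklore] -/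
theorem hessQ_add_rankOne_posDef_withKQ (θ V : Fin n → ℝ) (hV : ∀ i, 0 < V i) (hle : ∀ i, (mg.kQ i)⁻¹ ≤ (κQ i)⁻¹) {c : ℝ}
    (hP : (mg.hessQ θ V + c • Matrix.vecMulVec rot rot).PosDef) :
    ((mg.withKQ κQ).hessQ θ V + c • Matrix.vecMulVec rot rot).PosDef := by
  rw [hessQ_withKQ_eq_add, add_right_comm]
  exact hP.add_posSemidef (mg.kQShift_posSemidef κQ V hV hle)

/-- **Symmetry survives.** [folklore] -/
theorem hessQ_transpose_withKQ (θ V : Fin n → ℝ) (hsymm : (mg.hessQ θ V)ᵀ = mg.hessQ θ V) :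
    ((mg.withKQ κQ).hessQ θ V)ᵀ = (mg.withKQ κQ).hessQ θ V := by
  rw [hessQ_withKQ_eq_add, Matrix.transpose_add, hsymm, kQShift, Matrix.diagonal_transpose]

/-- **Sharp solver-free theorem, smaller Q–V gains.** Base model with `k_Pi, τ_Pi > 0`, `k_Qi > 0`, `V_i > 0`, `τ_Qi > 0`, symmetric `𝒬` and ONE certificate
`𝒬 + c·r rᵀ ≻ 0`; then for every `κ_Q` with `0 < κ_Qi` and `κ_Qi⁻¹ ≥ k_Qi⁻¹` (i.e. `κ_Qi ≤ k_Qi`), every complex eigenpair of `jacMatrix (withKQ κ_Q) (θ, V)` has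
`Re μ < 0` or is the rotation mode. CERTIFIED (MODEL N1, MV-6N); [cite: ShinZavala2020, Prop. 1] [cite: KunduEtAl2019, eqs. (4a)–(4c)]. No stability sentence. -/
theorem re_eig_neg_or_rotation_of_hessQ_withKQ (θ V : Fin n → ℝ) (hkP : ∀ i, 0 < mg.kP i) (hτP : ∀ i, 0 < mg.τP i) (hτQ : ∀ i, 0 < mg.τQ i)
    (hV : ∀ i, 0 < V i) (hsymm : (mg.hessQ θ V)ᵀ = mg.hessQ θ V) {c : ℝ} (hP : (mg.hessQ θ V + c • Matrix.vecMulVec rot rot).PosDef)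
    (hκ : ∀ i, 0 < κQ i) (hle : ∀ i, (mg.kQ i)⁻¹ ≤ (κQ i)⁻¹) {μ : ℂ} {v : Fin n ⊕ (Fin n ⊕ Fin n) → ℂ} (hv : v ≠ 0)
    (hJv : ((mg.withKQ κQ).jacMatrix θ V).map ((↑) : ℝ → ℂ) *ᵥ v = μ • v) :
    μ.re < 0 ∨ (μ = 0 ∧ ∃ a : ℂ, v = fun k => a * ((rot k : ℝ) : ℂ)) :=
  (mg.withKQ κQ).re_eig_neg_or_rotation_of_hessQ θ V (fun i => (hkP i).ne') (fun i => (hτP i).ne') (fun i => (hκ i).ne')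
    (fun i => (hV i).ne') (fun i => by rw [withKQ_kP, withKQ_τP]; exact div_pos (hkP i) (pow_pos (hτP i) 2))
    (fun i => by rw [withKQ_kQ, withKQ_τQ]; exact div_pos (mul_pos (hκ i) (hV i)) (hτQ i))
    (mg.hessQ_transpose_withKQ θ V hsymm) (mg.hessQ_add_rankOne_posDef_withKQ θ V hV hle hP) hv hJv

/-- **ALL `4n` LOOP PARAMETERS.** Base model with `k_Pi, τ_Pi > 0`, `V_i > 0`, symmetric `𝒬(θ, V)` and ONE certificate `𝒬(θ, V) + c·r rᵀ ≻ 0`. For EVERY positive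
`κ, τ_P′, τ_Q′` and every `κ_Q` with `0 < κ_Qi`, `κ_Qi⁻¹ ≥ k_Qi⁻¹`: every complex eigenpair `(μ, v)` of `jacMatrix ((withGainsTau κ τ_P′ τ_Q′).withKQ κ_Q) (θ, V)`
has `Re μ < 0`, or `μ = 0` with `v ∈ ℂ·r`. CERTIFIED (MODEL N1, MV-6N; no rate); [cite: ShinZavala2020, Prop. 1] [cite: KunduEtAl2019, eqs. (4a)–(4c)].
No stability sentence. -/
theorem re_eig_neg_or_rotation_of_hessQ_allLoops (κ τP' τQ' : Fin n → ℝ) (θ V : Fin n → ℝ) (hkP : ∀ i, 0 < mg.kP i) (hτP : ∀ i, 0 < mg.τP i)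
    (hV : ∀ i, 0 < V i) (hsymm : (mg.hessQ θ V)ᵀ = mg.hessQ θ V) {c : ℝ} (hP : (mg.hessQ θ V + c • Matrix.vecMulVec rot rot).PosDef)
    (hκ : ∀ i, 0 < κ i) (hτP' : ∀ i, 0 < τP' i) (hτQ' : ∀ i, 0 < τQ' i) (hκQ : ∀ i, 0 < κQ i) (hle : ∀ i, (mg.kQ i)⁻¹ ≤ (κQ i)⁻¹)
    {μ : ℂ} {v : Fin n ⊕ (Fin n ⊕ Fin n) → ℂ} (hv : v ≠ 0)
    (hJv : (((mg.withGainsTau κ τP' τQ').withKQ κQ).jacMatrix θ V).map ((↑) : ℝ → ℂ) *ᵥ v = μ • v) :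
    μ.re < 0 ∨ (μ = 0 ∧ ∃ a : ℂ, v = fun k => a * ((rot k : ℝ) : ℂ)) := by
  have h0 : ∀ i, 0 < mg.τP i / mg.kP i := fun i => div_pos (hτP i) (hkP i)
  have h1 : ∀ i, 0 < τP' i / κ i := fun i => div_pos (hτP' i) (hκ i)
  exact (mg.withGainsTau κ τP' τQ').re_eig_neg_or_rotation_of_hessQ_withKQ θ V (fun i => hκ i) (fun i => hτP' i) (fun i => hτQ' i) hV
    (mg.hessQ_transpose_withGainsTau h0 h1 θ V hsymm) (mg.hessQ_add_rankOne_posDef_withGainsTau h0 h1 θ V hP) hκQ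
    (fun i => by rw [withGainsTau_kQ]; exact hle i) hv hJv

/-- **No Jordan chain at the rotation zero, all `4n` loop parameters** (structural; inherited symmetry). [folklore] -/
theorem no_jordan_chain_at_zero_of_hessQ_allLoops (κ τP' τQ' : Fin n → ℝ) (θ V : Fin n → ℝ) (hkP : ∀ i, 0 < mg.kP i) (hτP : ∀ i, 0 < mg.τP i)
    (hV : ∀ i, 0 < V i) (hsymm : (mg.hessQ θ V)ᵀ = mg.hessQ θ V) (i₀ : Fin n)
    (hκ : ∀ i, 0 < κ i) (hτP' : ∀ i, 0 < τP' i) (hτQ' : ∀ i, 0 < τQ' i) (hκQ : ∀ i, 0 < κQ i)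
    {w : Fin n ⊕ (Fin n ⊕ Fin n) → ℂ}
    (hw : (((mg.withGainsTau κ τP' τQ').withKQ κQ).jacMatrix θ V).map ((↑) : ℝ → ℂ) *ᵥ w = fun k => ((rot k : ℝ) : ℂ)) : False := by
  have h0 : ∀ i, 0 < mg.τP i / mg.kP i := fun i => div_pos (hτP i) (hkP i)
  have h1 : ∀ i, 0 < τP' i / κ i := fun i => div_pos (hτP' i) (hκ i)
  exact ((mg.withGainsTau κ τP' τQ').withKQ κQ).no_jordan_chain_at_zero_of_hessQ θ V (fun i => (hκ i).ne') (fun i => (hτP' i).ne')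
    (fun i => (hκQ i).ne') (fun i => (hV i).ne')
    (fun i => by rw [withKQ_kP, withKQ_τP, withGainsTau_kP, withGainsTau_τP]; exact div_pos (hκ i) (pow_pos (hτP' i) 2))
    (fun i => by rw [withKQ_kQ, withKQ_τQ, withGainsTau_τQ]; exact div_pos (mul_pos (hκQ i) (hV i)) (hτQ' i))
    ((mg.withGainsTau κ τP' τQ').hessQ_transpose_withKQ θ V (mg.hessQ_transpose_withGainsTau h0 h1 θ V hsymm)) i₀ hw

end DroopMicrogrid

end Summit.Ventures.GridStability.Models

end
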